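import Mathlib
import HarnessLib

/-!
# Route `RadicialJung`, crux `CleanModels` (stmt-15917) — (C-curve) sub-line, brick S5a-field: `p`-degree `p` ⇒ every element is `Σ_{j<p} w_j^p z^j`

Lead `res-B-lead-1` g6 (plan `Cruxes/CleanModels/Lines/Sketch-memo-Ccurve-plan.md` §1 S5a).  OURS · counted 0.  Nothing here proves resolution in
characteristic `p`; resolution in char `p` is NOT proved.

Pure field theory in characteristic `p`: if `[κ : κ^p] = p` and `z ∈ κ` is not a `p`-th power, then `κ = κ^p(z)` and `{z^j}_{j<p}` spans `κ` over `κ^p`, so every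
`x ∈ κ` is `Σ_{j<p} w_j^p z^j` (`exists_sum_pow_mul_pow`).  With ✓ `finrank_frobenius_residueField_eq_pow` (tree: `[κ(P) : κ(P)^p] = p^{dim A/P}` over a perfect
field) this feeds ✓ `Ccurve.exists_sub_pow_eq_unit_mul_pow` (brick `…CcurveUnitCase`) at the residue field `κ(C)` of the centre curve in `stub_Cc_persistForm2`.
-/

noncomputable section

set_option linter.dupNamespace false

open Polynomial

namespace Summit.ResolutionOfSingularities.ResolutionOfSingularities.Theorems.RadicialJung.CleanModels.Ccurve

variable {κ : Type} [Field κ] (p : ℕ) [hp : Fact p.Prime] [CharP κ p]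

/-- In characteristic `p`, an element `b` of `κ^p` with `b = z^p` in `κ` forces `z ∈ κ^p` — so if `z` is not a `p`-th power, `z^p` is not a `p`-th power INSIDE the
subfield `κ^p`. [folklore] -/
theorem pow_ne_frobenius_of_not_pow (z : κ) (hz : ∀ y : κ, y ^ p ≠ z) (b : (frobenius κ p).fieldRange) :
    b ^ p ≠ ⟨z ^ p, (frobenius κ p).mem_fieldRange.mpr ⟨z, rfl⟩⟩ := by
  intro h
  have h' : ((b : κ)) ^ p = z ^ p := by
    have := congrArg (fun x : (frobenius κ p).fieldRange => (x : κ)) h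
    simpa using this
  have hbz : (b : κ) = z := by
    have h0 : ((b : κ) - z) ^ p = 0 := by rw [sub_pow_char, h', sub_self]
    exact sub_eq_zero.mp (eq_zero_of_pow_eq_zero h0)
  obtain ⟨y, hy⟩ := (frobenius κ p).mem_fieldRange.mp b.2
  exact hz y (by rw [← hbz, ← hy, frobenius_def])

/-- **`[κ : κ^p] = p` and `z ∉ κ^p` ⇒ every `x ∈ κ` is `Σ_{j<p} w_j^p z^j`** (the minimal polynomial of `z` over `κ^p` is `X^p − z^p`, of degree `p = [κ : κ^p]`, so
`κ = κ^p(z) = κ^p[z]` and `x = r(z)` with `deg r < p`). [folklore] -/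
theorem exists_sum_pow_mul_pow (hdeg : Module.finrank (frobenius κ p).fieldRange κ = p)
    (z : κ) (hz : ∀ y : κ, y ^ p ≠ z) (x : κ) :
    ∃ ws : Fin p → κ, x = ∑ j : Fin p, ws j ^ p * z ^ (j : ℕ) := by
  classical
  set F : Subfield κ := (frobenius κ p).fieldRange with hF
  set zp : F := ⟨z ^ p, (frobenius κ p).mem_fieldRange.mpr ⟨z, rfl⟩⟩ with hzp
  -- the minimal polynomial of `z` over `F = κ^p`
  set q : F[X] := X ^ p - C zp with hq
  have hqmonic : q.Monic := monic_X_pow_sub_C zp hp.out.ne_zero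
  have hqirr : Irreducible q := X_pow_sub_C_irreducible_of_prime hp.out (pow_ne_frobenius_of_not_pow p z hz)
  have hqz : aeval z q = 0 := by
    simp only [hq, hzp, map_sub, map_pow, aeval_X, aeval_C]
    rw [sub_eq_zero]; rfl
  have hint : IsIntegral F z := ⟨q, hqmonic, by rwa [← aeval_def]⟩
  have hmin : minpoly F z = q := (minpoly.eq_of_irreducible_of_monic hqirr hqz hqmonic).symm
  have hnat : (minpoly F z).natDegree = p := by rw [hmin, hq, natDegree_X_pow_sub_C]
  -- `F⟮z⟯ = ⊤` by degrees
  have hfd : Module.finrank F (IntermediateField.adjoin F ({z} : Set κ)) = p := by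
    rw [IntermediateField.adjoin.finrank hint, hnat]
  haveI : FiniteDimensional F κ := Module.finite_of_finrank_pos (by rw [hdeg]; exact hp.out.pos)
  have htop : IntermediateField.adjoin F ({z} : Set κ) = ⊤ := by
    apply IntermediateField.toSubalgebra_injective
    apply Subalgebra.toSubmodule_injective
    rw [IntermediateField.top_toSubalgebra, Algebra.top_toSubmodule]
    apply Submodule.eq_top_of_finrank_eq
    rw [Subalgebra.finrank_toSubmodule]
    change Module.finrank F (IntermediateField.adjoin F ({z} : Set κ)) = _
    rw [hfd, hdeg]
  -- `x = r(z)` with `r : F[X]` of degree `< p`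
  have hx : x ∈ Algebra.adjoin F ({z} : Set κ) := by
    rw [← IntermediateField.adjoin_simple_toSubalgebra_of_isAlgebraic hint.isAlgebraic, htop]
    exact Algebra.mem_top
  rw [Algebra.adjoin_singleton_eq_range_aeval] at hx
  obtain ⟨r₀, hr₀⟩ := hx
  set r : F[X] := r₀ %ₘ q with hr
  have hxr : x = aeval z r := by
    rw [hr, ← hmin, aeval_modByMonic_eq_self_of_root (minpoly.aeval F z)]
    exact hr₀.symm
  have hdeg_r : r.natDegree < p := by
    by_cases hr0 : r = 0
    · rw [hr0, natDegree_zero]; exact hp.out.pos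
    · have h1 : r.degree < q.degree := by rw [hr]; exact degree_modByMonic_lt r₀ hqmonic
      have h2 := natDegree_lt_natDegree hr0 h1
      rwa [hq, natDegree_X_pow_sub_C] at h2
  -- read off the coefficients, each a `p`-th power
  have hcoef : ∀ j : ℕ, ∃ w : κ, w ^ p = ((r.coeff j : F) : κ) := fun j => by
    obtain ⟨w, hw⟩ := (frobenius κ p).mem_fieldRange.mp (r.coeff j).2
    exact ⟨w, by rw [← hw, frobenius_def]⟩
  choose w hw using hcoef
  refine ⟨fun j => w j, ?_⟩
  rw [hxr, aeval_eq_sum_range' hdeg_r, Finset.sum_range]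
  refine Finset.sum_congr rfl fun j _ => ?_
  rw [hw, Algebra.smul_def]
  rfl

end Summit.ResolutionOfSingularities.ResolutionOfSingularities.Theorems.RadicialJung.CleanModels.Ccurve

end
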